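import Literature.AnabelianGeometry.EtaleTheta.FreeProfinitePermBasis
import Literature.AnabelianGeometry.EtaleTheta.FreeProfinitePermBasisShadows
import Literature.AnabelianGeometry.EtaleTheta.FreeProfinitePermBasisCentralizer
import Literature.AnabelianGeometry.EtaleTheta.FreeProfinitePermBasisTowers
import Mathlib.GroupTheory.SemidirectProduct
import Mathlib.GroupTheory.SpecificGroups.Cyclic
import Mathlib.GroupTheory.GroupAction.Basic
import Mathlib.Data.ZMod.QuotientGroup
import HarnessLib

/-!
# (PBF₀): a fixed-point-free basis permutation of prime order fixes only `1` in the free profinite group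
# (PL3-TREEFREE §3.3, with the referee's repair; R-free B-tower) — THEOREMS ONLY (v3; the tower is in `…Towers.lean`)

For `σ` free of prime order `q` on the finite basis `S`: `C := ⟨σ⟩ ≤ Perm S` (order `q`), `Λ := FreeGroup S ⋊ C`.  For
every finite-index normal `M ⊴ Λ`, `B̄_M ≤ Λ/M` is the (finite) subgroup generated by the classes of one representative
letter per `C`-orbit; «letter `s = σ^{i}(rep s)` ↦ `c^{i} · \overline{rep s} · c^{-i}`, `c ↦ c`» is a homomorphism
`f_M : Λ → C ∗ B̄_M` (the exponents are well defined because `C` acts FREELY), and `g_M : C ∗ B̄_M → Λ/M` satisfies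
`g_M ∘ f_M = (Λ → Λ/M)`.  In `Λ̂`, an element `γ` commuting with `x := η(c)` maps under `f̂_M` into the centraliser of
`η(c)` in `(C ∗ B̄_M)^`, which is `⟨η c⟩` by `centralizer_toCompletion_inl_eq_zpowers` (`FreeProfinitePermBasisCentralizer.lean`, NO hypotheses); so every
`M`-shadow of `γ` is the shadow of a power of `x` and the ENDGAME lemma gives `γ ∈ ⟨x⟩`.  For `γ := ι̂(w)`, `w ∈ F̂(S)`
fixed by `permHat σ` (`ι̂ ∘ permHat σ = Inn(x) ∘ ι̂`), projecting to `C` shows `ι̂ w = 1`, and `ι̂` is injective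
(finite-index comparison): `w = 1`.  MAIN THEOREM (statement of the ROUTE-PBF P-chain, this packet) [cite: RibesZalesskii2010, §3.2]
`permBasisFixedPointsFree_holds : PermBasisFixedPointsFree` (v2: no hypotheses).

HONEST FRAMING. Classical profinite group theory (free profinite groups as completions of free groups, free profinite
products of finite groups as completions of free products); theorems only, no named-fact hypothesis; the four candidate `Prop`s of
`FreeProfinitePermBasis.lean` are all PROVED in this packet (`_holds`); no (E)-class module and no `SettingModel*` file is
imported; nothing of [EtTh]/[IUTchII]/[IUTchIII] in print is asserted; CELL hextΔ/hΘ UNDECIDED-AT-MODEL; no side is taken on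
[IUTchIII] Cor. 3.12; nothing here says abc is proved or refuted.  abc-iut cell, programme P-L2, rung (L3′), ROUTE-PBF,
P-chain (seat abc-iut-w6-d081 GEN 23; v3 GEN 24); desk: PL3-TREEFREE (abc-iut-L6-t19 g22) + PL3-PBF-READ (this seat).
-/

namespace Literature.AnabelianGeometry.EtaleTheta.SettingModel.TreeFree

open CategoryTheory Topology
open Literature.IUT.HodgeTheaters (profiniteCompletion toCompletion)

universe u

section PBF0

variable {S : Type u}

variable {σ : Equiv.Perm S}

/-! ### The completion `Λ̂` -/

/-- `ι̂ ∘ permHat σ = Inn(η c) ∘ ι̂` for `ι = inl : FreeGroup S → Λ`. [folklore] -/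
private theorem mapHat_inl_permHat (w : profiniteCompletion (FreeGroup S)) :
    mapHat (SemidirectProduct.inl : FreeGroup S →* Lam σ) (permHat σ w) =
      toCompletion (Lam σ) (SemidirectProduct.inr (cgen σ)) * mapHat (SemidirectProduct.inl : FreeGroup S →* Lam σ) w *
        (toCompletion (Lam σ) (SemidirectProduct.inr (cgen σ)))⁻¹ := by
  have h := Literature.IUT.HodgeTheaters.ProfiniteCompletion.eq_of_forall_toCompletion
    (ψ₁ := fun v => mapHat (SemidirectProduct.inl : FreeGroup S →* Lam σ) (permHat σ v))
    (ψ₂ := fun v => toCompletion (Lam σ) (SemidirectProduct.inr (cgen σ)) *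
      mapHat (SemidirectProduct.inl : FreeGroup S →* Lam σ) v * (toCompletion (Lam σ) (SemidirectProduct.inr (cgen σ)))⁻¹)
    ((continuous_mapHat _).comp (continuous_permHat σ))
    ((continuous_const.mul (continuous_mapHat _)).mul continuous_const)
    (fun v => by
      simp only [permHat_toCompletion, mapHat_toCompletion, ← map_inv, ← map_mul]
      congr 1
      have : FreeGroup.map σ v = cycAct σ (cgen σ) v := rfl
      rw [this, SemidirectProduct.inl_aut])
  exact congrFun h w



/-- `ι̂ = mapHat inl : F̂(S) → Λ̂` is injective (`inl(FreeGroup S)` has finite index `|C|` in `Λ`; the LANDED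
finite-index comparison `profiniteCompletionMap_subtype_injective_and_range`). [folklore] -/
private theorem mapHat_inl_injective [Finite S] :
    Function.Injective (mapHat (SemidirectProduct.inl : FreeGroup S →* Lam σ)) := by
  haveI : Finite (Cyc σ) := inferInstance
  -- `range inl = ker rightHom` has finite index
  haveI : (SemidirectProduct.inl : FreeGroup S →* Lam σ).range.FiniteIndex := by
    rw [SemidirectProduct.range_inl_eq_ker_rightHom]
    refine ⟨?_⟩
    rw [Subgroup.index_ker]
    exact Nat.card_pos.ne'
  -- inl = subtype ∘ rangeRestrict, and rangeRestrict is an isomorphism onto the range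
  let e : FreeGroup S ≃* (SemidirectProduct.inl : FreeGroup S →* Lam σ).range :=
    MonoidHom.ofInjective SemidirectProduct.inl_injective
  have hfac : (SemidirectProduct.inl : FreeGroup S →* Lam σ) =
      (SemidirectProduct.inl : FreeGroup S →* Lam σ).range.subtype.comp (e : FreeGroup S →* _) :=
    MonoidHom.ext fun _ => rfl
  rw [hfac]
  intro w₁ w₂ h
  rw [mapHat_comp_apply, mapHat_comp_apply] at h
  have h1 := (Literature.IUT.HodgeTheaters.ProfiniteCompletion.profiniteCompletionMap_subtype_injective_and_range
    (SemidirectProduct.inl : FreeGroup S →* Lam σ).range).1 h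
  exact mapHat_injective_of_mulEquiv e h1


/-- **(PBF₀) — no hypotheses (v2).**  PL3-TREEFREE §3.3 with the referee's repair and the R-free B-tower (see the module
docstring; towers in `FreeProfinitePermBasisTowers.lean`); the centraliser input is the Kurosh-free
`centralizer_toCompletion_inl_eq_zpowers`.  Statement of the ROUTE-PBF P-chain (this packet); cf. Ribes–Zalesskii, *Profinite Groups*, §3.2. [cite: RibesZalesskii2010, §3.2] -/
theorem permBasisFixedPointsFree_holds : PermBasisFixedPointsFree.{u} := by
  intro S _ σ q hq hσq hfree w hw
  classical
  rcases isEmpty_or_nonempty S with hS | hS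
  · -- empty basis: `FreeGroup S` is trivial, so is every shadow
    apply eq_of_forall_shadow_eq
    intro M
    obtain ⟨d, hd⟩ := QuotientGroup.mk_surjective (shadow M w)
    rw [← hd, Subsingleton.elim d 1]
    rfl
  obtain ⟨s₀⟩ := hS
  -- notation
  set x : profiniteCompletion (Lam σ) := toCompletion (Lam σ) (SemidirectProduct.inr (cgen σ)) with hx
  set γ : profiniteCompletion (Lam σ) := mapHat (SemidirectProduct.inl : FreeGroup S →* Lam σ) w with hγdef
  -- γ commutes with x
  have hγ : γ * x = x * γ := by
    have h := mapHat_inl_permHat (σ := σ) w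
    rw [hw] at h
    -- h : γ = x * γ * x⁻¹
    calc γ * x = x * γ * x⁻¹ * x := by rw [← h]
      _ = x * γ := by rw [inv_mul_cancel_right]
  -- x has finite order (dividing q)
  have hcq : cgen σ ^ q = 1 := Subtype.ext (by simp [hσq])
  have hxq : x ^ q = 1 := by rw [hx, ← map_pow, ← map_pow, hcq, map_one, map_one]
  have hZfin : (Subgroup.zpowers x : Set (profiniteCompletion (Lam σ))).Finite :=
    (isOfFinOrder_iff_pow_eq_one.mpr ⟨q, hq.pos, hxq⟩).finite_zpowers
  -- C has prime order, c ≠ 1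
  haveI : Fintype (Cyc σ) := Fintype.ofFinite _
  have hcard : (Fintype.card (Cyc σ)).Prime := by
    rw [Fintype.card_eq_nat_card, card_Cyc hq hσq (hfree s₀)]; exact hq
  have hc1 : cgen σ ≠ 1 := by
    intro h
    apply hfree s₀
    have := congrArg (fun g : Cyc σ => (g : Equiv.Perm S) s₀) h
    simpa using this
  -- THE TOWER: γ ∈ ⟨x⟩
  have hγZ : γ ∈ (Subgroup.zpowers x : Set (profiniteCompletion (Lam σ))) := by
    apply mem_of_forall_exists_shadow_eq_of_finite hZfin
    intro M
    haveI : Finite (Lam σ ⧸ M.toSubgroup) := Subgroup.finite_quotient_of_finiteIndex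
    letI : Fintype (Bbar σ M) := Fintype.ofFinite _
    -- f̂_M γ commutes with η(inl c)
    have hfx : mapHat (fM hq hσq hfree (M := M)) x =
        toCompletion (Monoid.Coprod (Cyc σ) (Bbar σ M)) (Monoid.Coprod.inl (cgen σ)) := by
      rw [hx, mapHat_toCompletion, fM_inr]
    have hcomm : mapHat (fM hq hσq hfree (M := M)) γ *
        toCompletion (Monoid.Coprod (Cyc σ) (Bbar σ M)) (Monoid.Coprod.inl (cgen σ)) =
        toCompletion (Monoid.Coprod (Cyc σ) (Bbar σ M)) (Monoid.Coprod.inl (cgen σ)) *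
          mapHat (fM hq hσq hfree (M := M)) γ := by
      rw [← hfx, ← map_mul, ← map_mul, hγ]
    have hmem : mapHat (fM hq hσq hfree (M := M)) γ ∈
        Subgroup.centralizer ({toCompletion (Monoid.Coprod (Cyc σ) (Bbar σ M)) (Monoid.Coprod.inl (cgen σ))} :
          Set (profiniteCompletion (Monoid.Coprod (Cyc σ) (Bbar σ M)))) :=
      Subgroup.mem_centralizer_singleton_iff.mpr hcomm
    rw [centralizer_toCompletion_inl_eq_zpowers hcard hc1, Subgroup.mem_zpowers_iff] at hmem
    obtain ⟨k, hk⟩ := hmem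
    refine ⟨x ^ k, ⟨k, rfl⟩, ?_⟩
    -- f̂_M (x^k) = f̂_M γ
    have heq : mapHat (fM hq hσq hfree (M := M)) (x ^ k) = mapHat (fM hq hσq hfree (M := M)) γ := by
      rw [map_zpow, hfx, hk]
    -- pull the equality back to the M-shadow through the level ⊥ of Λ/M along g_M
    let B0 : FiniteIndexNormalSubgroup (Lam σ ⧸ M.toSubgroup) := FiniteIndexNormalSubgroup.ofSubgroup ⊥
    refine shadow_eq_of_mapHat_eq (fM hq hσq hfree (M := M)) (B0.comap (gM (M := M))) ?_ heq
    rw [FiniteIndexNormalSubgroup.toSubgroup_comap, FiniteIndexNormalSubgroup.toSubgroup_comap,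
      Subgroup.comap_comap, gM_comp_fM hq hσq hfree]
    simp [B0, MonoidHom.comap_bot, QuotientGroup.ker_mk']
  obtain ⟨k, hk⟩ := Subgroup.mem_zpowers_iff.mp hγZ
  -- project to C: `ι̂ w` dies, powers of `x` are detected
  have h1 : mapHat (SemidirectProduct.rightHom : Lam σ →* Cyc σ) γ = 1 := by
    rw [hγdef, ← mapHat_comp_apply, SemidirectProduct.rightHom_comp_inl, mapHat_one_apply]
  have h2 : mapHat (SemidirectProduct.rightHom : Lam σ →* Cyc σ) (x ^ k) = toCompletion (Cyc σ) (cgen σ ^ k) := by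
    rw [map_zpow, hx, mapHat_toCompletion, SemidirectProduct.rightHom_inr, map_zpow]
  have hck : cgen σ ^ k = 1 := by
    apply toCompletion_injective_of_finite
    rw [← h2, hk, h1, map_one]
  have hγ1 : γ = 1 := by
    rw [← hk, hx, ← map_zpow, ← map_zpow, hck, map_one, map_one]
  apply mapHat_inl_injective (σ := σ)
  rw [← hγdef, hγ1, map_one]


end PBF0

end Literature.AnabelianGeometry.EtaleTheta.SettingModel.TreeFree
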